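import Mathlib
import Summits.SmoothPoincare4.SmoothPoincare4.Theorems.SullivanDualTameOrBrodyR4CoreAChart
import Summits.SmoothPoincare4.SmoothPoincare4.Theorems.SullivanDualTameOrBrodyR4HelperFarCrossings
import Summits.SmoothPoincare4.SmoothPoincare4.Theorems.SullivanDualTameOrBrodyR4HelperEmbeddingPersists

/-!
# Small normal graphs over a member are members (stub `helper_zerosMember`, line Sketch)

Crux `stmt-SmoothPoincare4-7826` (`TameOrBrodyR4`), line `Sketch`, CORE-A (the implicit function
theorem chart `CoreA.ChartData` at a pencil member `u₀` of asymptotic value `b₀`). This file is the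
SOFT half of "small zeros of the vorticity map are pencil members": a normal graph
`U = u₀ + Ψ v` over `u₀` in the adapted frame `Ψ` of the chart, with `v : ℂ → ℂ²` `C¹`-small
(`‖v‖ ≤ θ`, `‖dv‖ ≤ θ`), which is already known to be `C^∞`, flat-`J`-holomorphic and to have
the member asymptotics (`Q ∘ U → b₀ + β`, `P ∘ U - id → 0`), IS a pencil member
(`IsPencilMember`), as soon as `θ` is small (depending on the chart only).

Of the eight clauses of `IsPencilMember` four are hypotheses; the two far-crossing clauses are
`helper_farCrossings` (generalised argument principle); injectivity and immersivity come from
`helper_embeddingPersists` (embeddings are `C¹`-open on a disc) on the disc `‖ξ‖ ≤ ρ`,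
`ρ = max L (2R + 3)` with `L` a tail radius of `u₀` (`‖P (u₀ ξ) - ξ‖ < 1` for `‖ξ‖ ≥ L`,
`FarCrossings.exists_tail_radius`): for `‖ξ‖ ≥ ρ` one has
`|P (U ξ)| ≥ |P (u₀ ξ)| - ‖Ψ ξ (v ξ)‖ > (2R + 2) - 1`, and on the disc `‖U - u₀‖ ≤ C_Ψ θ`,
`‖dU - du₀‖ ≤ (C_Ψ + M) θ` (product rule, `M` a bound of `dΨ` on the compact disc).
-/

-- the registered namespace `Summit.SmoothPoincare4.SmoothPoincare4.…` repeats a component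
set_option linter.dupNamespace false

noncomputable section

open scoped ContDiff Topology
open Filter Set Metric Literature.Geometry.Symplectic

namespace Summit.SmoothPoincare4.SmoothPoincare4.Cruxes.TameOrBrodyR4.Sketch

/-- Local notation for the model space `ℝ⁴ = EuclideanSpace ℝ (Fin 4)`. -/
local notation "E4" => EuclideanSpace ℝ (Fin 4)

namespace ZerosMember

/-- **Product rule for a normal graph**: the derivative of `ξ ↦ u₀ ξ + Ψ ξ (v ξ)`. -/
theorem hasFDerivAt_graph {u₀ : ℂ → E4} {Ψ : ℂ → (ℂ × ℂ) →L[ℝ] E4} {v : ℂ → ℂ × ℂ}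
    (hu₀ : Differentiable ℝ u₀) (hΨ : Differentiable ℝ Ψ) (hv : Differentiable ℝ v) (ξ : ℂ) :
    HasFDerivAt (fun ξ => u₀ ξ + Ψ ξ (v ξ))
      (fderiv ℝ u₀ ξ + ((Ψ ξ).comp (fderiv ℝ v ξ) + (fderiv ℝ Ψ ξ).flip (v ξ))) ξ :=
  (hu₀ ξ).hasFDerivAt.add ((hΨ ξ).hasFDerivAt.clm_apply (hv ξ).hasFDerivAt)

/-- **`C¹`-distance of a normal graph from the member.** If `‖Ψ ξ‖ ≤ C`, `‖dΨ ξ‖ ≤ M`,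
`‖v ξ‖ ≤ θ` and `‖dv ξ‖ ≤ θ`, then at `ξ` the graph `U = u₀ + Ψ v` satisfies
`‖U ξ - u₀ ξ‖ ≤ C θ` and `‖dU ξ - du₀ ξ‖ ≤ (C + M) θ`. -/
theorem graph_close {u₀ : ℂ → E4} {Ψ : ℂ → (ℂ × ℂ) →L[ℝ] E4} {v : ℂ → ℂ × ℂ}
    (hu₀ : Differentiable ℝ u₀) (hΨ : Differentiable ℝ Ψ) (hv : Differentiable ℝ v) {ξ : ℂ}
    {C M θ : ℝ} (hC : ‖Ψ ξ‖ ≤ C) (hM : ‖fderiv ℝ Ψ ξ‖ ≤ M) (hv0 : ‖v ξ‖ ≤ θ)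
    (hv1 : ‖fderiv ℝ v ξ‖ ≤ θ) :
    ‖(u₀ ξ + Ψ ξ (v ξ)) - u₀ ξ‖ ≤ C * θ ∧
      ‖fderiv ℝ (fun ξ => u₀ ξ + Ψ ξ (v ξ)) ξ - fderiv ℝ u₀ ξ‖ ≤ (C + M) * θ := by
  have hC0 : 0 ≤ C := (norm_nonneg _).trans hC
  have hM0 : 0 ≤ M := le_trans (norm_nonneg (fderiv ℝ Ψ ξ)) hM
  constructor
  · rw [add_sub_cancel_left]
    calc ‖Ψ ξ (v ξ)‖ ≤ ‖Ψ ξ‖ * ‖v ξ‖ := (Ψ ξ).le_opNorm _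
      _ ≤ C * θ := mul_le_mul hC hv0 (norm_nonneg _) hC0
  · rw [(hasFDerivAt_graph hu₀ hΨ hv ξ).fderiv, add_sub_cancel_left]
    calc ‖(Ψ ξ).comp (fderiv ℝ v ξ) + (fderiv ℝ Ψ ξ).flip (v ξ)‖
        ≤ ‖(Ψ ξ).comp (fderiv ℝ v ξ)‖ + ‖(fderiv ℝ Ψ ξ).flip (v ξ)‖ := norm_add_le _ _
      _ ≤ ‖Ψ ξ‖ * ‖fderiv ℝ v ξ‖ + ‖(fderiv ℝ Ψ ξ).flip‖ * ‖v ξ‖ :=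
          add_le_add (ContinuousLinearMap.opNorm_comp_le _ _)
            (ContinuousLinearMap.le_opNorm _ _)
      _ = ‖Ψ ξ‖ * ‖fderiv ℝ v ξ‖ + ‖fderiv ℝ Ψ ξ‖ * ‖v ξ‖ := by
          rw [ContinuousLinearMap.opNorm_flip]
      _ ≤ C * θ + M * θ :=
          add_le_add (mul_le_mul hC hv1 (norm_nonneg _) hC0)
            (mul_le_mul hM hv0 (norm_nonneg _) hM0)
      _ = (C + M) * θ := by ring

/-- **The far `P`-coordinate of a small normal graph.** If `‖P (u₀ ξ) - ξ‖ < 1`,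
`2R + 3 ≤ ‖ξ‖`, `|P x| ≤ ‖x‖` for the perturbation `x` and `‖x‖ ≤ 1`, then `2R < |P (u₀ ξ + x)|`. -/
theorem far_of_tail {P : E4 →L[ℝ] ℂ} {u₀ : ℂ → E4} {R : ℝ} {ξ : ℂ} {x : E4}
    (h1 : ‖P (u₀ ξ) - ξ‖ < 1) (h2 : 2 * R + 3 ≤ ‖ξ‖) (hPx : ‖P x‖ ≤ ‖x‖) (hx : ‖x‖ ≤ 1) :
    2 * R < ‖P (u₀ ξ + x)‖ := by
  have h3 : ‖ξ‖ - ‖P (u₀ ξ)‖ ≤ ‖ξ - P (u₀ ξ)‖ := norm_sub_norm_le _ _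
  have h4 : ‖ξ - P (u₀ ξ)‖ = ‖P (u₀ ξ) - ξ‖ := norm_sub_rev _ _
  have h5 : ‖P (u₀ ξ)‖ ≤ ‖P (u₀ ξ) + P x‖ + ‖P x‖ := norm_le_add_norm_add _ _
  rw [map_add]
  linarith

end ZerosMember

/-- **Registered stub `helper_zerosMember`: a `C¹`-small normal graph over a member which is
smooth, flat-`J`-holomorphic and has the member asymptotics is a pencil member.** For chart data
`𝒞` at the member `u₀` (value `b₀`) there is `θ > 0` such that for every `β`, `|β| < θ`, and
every `C¹` map `v : ℂ → ℂ²` with `‖v‖ ≤ θ`, `‖dv‖ ≤ θ`, the graph `U = u₀ + 𝒞.Ψ v` — if `C^∞`,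
flat-`J`-holomorphic, with `Q ∘ U → b₀ + β` and `P ∘ U - id → 0` at infinity — is a member with
asymptotic value `b₀ + β` (far crossings: `helper_farCrossings`; embeddedness:
`helper_embeddingPersists`). -/
theorem helper_zerosMember (J : E4 → E4 →L[ℝ] E4) (R : ℝ) (P Q : E4 →L[ℝ] ℂ) (eP eQ : ℂ →L[ℝ] E4)
    (hR : 0 < R) (hJs : ContDiff ℝ ∞ J) (hJ2 : ∀ x v, J x (J x v) = -v)
    (hPQ : IsCoordFrame P Q eP eQ)
    (hJP : ∀ x : E4, R ≤ ‖x‖ → ∀ v, P (J x v) = Complex.I * P v)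
    (hJQ : ∀ x : E4, R ≤ ‖x‖ → ∀ v, Q (J x v) = Complex.I * Q v)
    (b₀ : ℂ) (u₀ : ℂ → E4) (hu₀ : IsPencilMember J R P Q b₀ u₀)
    (𝒞 : CoreA.ChartData J R P Q eP eQ b₀ u₀) :
    ∃ θ > (0 : ℝ), ∀ (β : ℂ) (v : ℂ → ℂ × ℂ), ‖β‖ < θ → ContDiff ℝ 1 v →
      (∀ ξ, ‖v ξ‖ ≤ θ) → (∀ ξ, ‖fderiv ℝ v ξ‖ ≤ θ) →
      ContDiff ℝ ∞ (fun ξ => u₀ ξ + 𝒞.Ψ ξ (v ξ)) →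
      IsJHolomorphicFlat J (fun ξ => u₀ ξ + 𝒞.Ψ ξ (v ξ)) →
      Tendsto (fun ξ => Q (u₀ ξ + 𝒞.Ψ ξ (v ξ))) (cocompact ℂ) (𝓝 (b₀ + β)) →
      Tendsto (fun ξ => P (u₀ ξ + 𝒞.Ψ ξ (v ξ)) - ξ) (cocompact ℂ) (𝓝 0) →
      IsPencilMember J R P Q (b₀ + β) (fun ξ => u₀ ξ + 𝒞.Ψ ξ (v ξ)) := by
  obtain ⟨hu₀s, -, -, -, -, hP₀, -, -⟩ := id hu₀
  have hd₀ : Differentiable ℝ u₀ := hu₀s.differentiable (by simp)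
  have hdΨ : Differentiable ℝ 𝒞.Ψ := 𝒞.hΨs.differentiable (by simp)
  -- (1) a tail radius `L` of `u₀` and the disc radius `ρ ≥ max L (2R + 3)`
  obtain ⟨L, hL⟩ := FarCrossings.exists_tail_radius (f := fun ξ => P (u₀ ξ)) hP₀
  obtain ⟨ρ, hρL, hρR⟩ : ∃ ρ : ℝ, L ≤ ρ ∧ 2 * R + 3 ≤ ρ :=
    ⟨max L (2 * R + 3), le_max_left _ _, le_max_right _ _⟩
  have hρ : 0 < ρ := by linarith
  -- (2) the persistence modulus `δ` of `u₀` on the disc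
  obtain ⟨δ, hδ, hemb⟩ := helper_embeddingPersists J R P Q eP eQ hR hPQ b₀ u₀ hu₀ ρ hρ
  -- (3) a bound `M` for `dΨ` on the compact disc, and the frame bound `C_Ψ ≥ 0`
  obtain ⟨M, hM⟩ := (isCompact_closedBall (0 : ℂ) ρ).exists_bound_of_continuousOn
    (𝒞.hΨs.continuous_fderiv (by simp)).continuousOn
  have hC0 : 0 ≤ 𝒞.CΨ := (norm_nonneg _).trans (𝒞.hΨbd 0)
  have hM0 : 0 ≤ M := (norm_nonneg _).trans (hM 0 (mem_closedBall_self hρ.le))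
  -- (4) the smallness constant `θ`
  obtain ⟨θ, hθ, hCθ, hCMθ⟩ :
      ∃ θ : ℝ, 0 < θ ∧ 𝒞.CΨ * θ ≤ 1 ∧ (𝒞.CΨ + M) * θ ≤ δ := by
    have hK : 0 < 𝒞.CΨ + M + 1 := by linarith
    refine ⟨min 1 δ / (𝒞.CΨ + M + 1), div_pos (lt_min one_pos hδ) hK, ?_, ?_⟩
    · calc 𝒞.CΨ * (min 1 δ / (𝒞.CΨ + M + 1))
          ≤ (𝒞.CΨ + M + 1) * (min 1 δ / (𝒞.CΨ + M + 1)) :=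
            mul_le_mul_of_nonneg_right (by linarith) (div_pos (lt_min one_pos hδ) hK).le
        _ = min 1 δ := mul_div_cancel₀ _ hK.ne'
        _ ≤ 1 := min_le_left _ _
    · calc (𝒞.CΨ + M) * (min 1 δ / (𝒞.CΨ + M + 1))
          ≤ (𝒞.CΨ + M + 1) * (min 1 δ / (𝒞.CΨ + M + 1)) :=
            mul_le_mul_of_nonneg_right (by linarith) (div_pos (lt_min one_pos hδ) hK).le
        _ = min 1 δ := mul_div_cancel₀ _ hK.ne'
        _ ≤ δ := min_le_right _ _
  refine ⟨θ, hθ, ?_⟩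
  intro β v _hβ hv hv0 hv1 hUs hUJ hQ hP
  have hdv : Differentiable ℝ v := hv.differentiable (by simp)
  -- the two far-crossing clauses
  obtain ⟨hfarc, hfard⟩ :=
    helper_farCrossings J R P Q eP eQ hR hJs hJ2 hPQ hJP hJQ _ hUs hUJ hP
  -- the perturbation is small: `‖Ψ ξ (v ξ)‖ ≤ C_Ψ θ ≤ 1`
  have hsmall : ∀ ξ, ‖𝒞.Ψ ξ (v ξ)‖ ≤ 1 := fun ξ =>
    calc ‖𝒞.Ψ ξ (v ξ)‖ ≤ ‖𝒞.Ψ ξ‖ * ‖v ξ‖ := (𝒞.Ψ ξ).le_opNorm _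
      _ ≤ 𝒞.CΨ * θ := mul_le_mul (𝒞.hΨbd ξ) (hv0 ξ) (norm_nonneg _) hC0
      _ ≤ 1 := hCθ
  -- off the disc the `P`-coordinate is far
  have hfarU : ∀ ξ : ℂ, ρ ≤ ‖ξ‖ → 2 * R < ‖P (u₀ ξ + 𝒞.Ψ ξ (v ξ))‖ := fun ξ hξ =>
    ZerosMember.far_of_tail (hL ξ (hρL.trans hξ)) (hρR.trans hξ) (PencilDefs.norm_P_le hPQ _)
      (hsmall ξ)
  -- on the disc the graph is `δ`-close to `u₀` in `C¹`
  have hclose : ∀ ξ ∈ Metric.closedBall (0 : ℂ) ρ,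
      ‖(u₀ ξ + 𝒞.Ψ ξ (v ξ)) - u₀ ξ‖ ≤ δ ∧
        ‖fderiv ℝ (fun ξ => u₀ ξ + 𝒞.Ψ ξ (v ξ)) ξ - fderiv ℝ u₀ ξ‖ ≤ δ := by
    intro ξ hξ
    obtain ⟨h0, h1⟩ :=
      ZerosMember.graph_close hd₀ hdΨ hdv (𝒞.hΨbd ξ) (hM ξ hξ) (hv0 ξ) (hv1 ξ)
    have hCθ' : 𝒞.CΨ * θ ≤ (𝒞.CΨ + M) * θ := mul_le_mul_of_nonneg_right (by linarith) hθ.le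
    exact ⟨h0.trans (hCθ'.trans hCMθ), h1.trans hCMθ⟩
  have hU1 : ContDiff ℝ 1 (fun ξ => u₀ ξ + 𝒞.Ψ ξ (v ξ)) := hUs.of_le (by simp)
  obtain ⟨hinj, himm⟩ := hemb _ hU1 hfarc hfard hfarU hclose
  exact ⟨hUs, hUJ, hinj, himm, hQ, hP, hfarc, hfard⟩

end Summit.SmoothPoincare4.SmoothPoincare4.Cruxes.TameOrBrodyR4.Sketch
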